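import Literature.NumberTheory.Rogawski1990.FinExplicitTransferFactorKappaEvenEigenline                  -- ★ B-p12 (β) p842227: the κ = +1 reading (imports the κ-ite lemmas)
import Literature.NumberTheory.Rogawski1990.LocalStableClassesNonsplitTypeTwoKappa                       -- ★ B-p14: `mulVec_col_eq_smul_of_blockFrame`, `blockFrame_apply_corner` (+ ★ `twistGram_blockFrame_eq`)
import Literature.NumberTheory.Rogawski1990.UnitFundamentalLemmaInertIrredClauseOfValuesStubFrame        -- ★ B-p14: `mul_eq_mul_reindex_fromBlocks_of_conj_endoEmbLocal_eq`, `irreducible_charpoly_of_not_exists_isRoot_eval`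
import HarnessLib

/-!
# `κ_v(γ_H, γ′) = −1` READ ON THE EIGENLINE (type (2)): an ANISOTROPIC `γ₂`-eigenvector of `γ′` exists, and its `H′_v`-value has ODD order
(Rogawski (1990) §4.3 p. 43, §3.6 p. 31; O'Meara 63:16)

Topic `NumberTheory/Rogawski1990`; namespace `Literature.NumberTheory.Rogawski1990`.  THEOREMS ONLY (no definition, no named fact, no instance, no notation,
no `sorry`).  Cell `pub/hodgecm-mathlib`, crux H413 = `stmt-HodgeConjecture-24833`, line «N7nsCount», value stub `stub_irredGValueNeg` (:1269, κ = −1): brick **(β⁻)** of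
LEAD F0P3a-plan (g9) T8-153 — the κ = −1 twin of ★ B-p12 `FinExplicitTransferFactorKappaEvenEigenline` (p842227).  The one new point: for κ = −1 the definition of ★
`finKappaAt` does not by itself exclude an ISOTROPIC eigenvector, so §1 produces, for a TYPE-(2) match (`χ_g` with no root in `L_w`), the eigenvector column of the
block frame `c` of the match (`b c = c [g 0; 0 u]`, ★ B-p14 `mul_eq_mul_reindex_fromBlocks_of_conj_endoEmbLocal_eq`), whose `H′_v`-value is the corner `g₃ ≠ 0` of the
block-diagonal Gram matrix `ᵗσ(c) H′_v c` (★ `twistGram_blockFrame_eq`, ★ `blockFrame_gram_hermitian`).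
HONEST LABEL: HC_CM is proved only modulo the printed citations (2 remaining named inputs hLiu418, h413) until rung 0 closes; bookkeeping.

* §1 `twistGram_apply_self_eq_formValue` (the diagonal Gram entry IS the `H`-value of the column) and
  **`exists_anisotropic_eigenvector_of_isLocalNormPair`** — `∃ p′ ≠ 0, γ′ p′ = γ₂ p′ ∧ p′ᴴ H′_v p′ ≠ 0` for a type-(2) match.
* §2 **`odd_log_valued_of_finKappaAt_eq_neg_one`** — `κ_v = −1` ⇒ `ord_v x₀` ODD for the value `x₀ ∈ L⁺_v` of any non-zero eigenvector with non-zero value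
  (★ `finKappaAt_eq_ite_even_of_nonsplit_of_isUnramifiedIn`).

## References
* [Rogawski1990] J. D. Rogawski, *Automorphic Representations of Unitary Groups in Three Variables*, Ann. of Math. Stud. 123 (1990): §3.6 p. 31, §4.3 p. 43, §14.6 p. 242.
* [Omeara1963] O. T. O'Meara, *Introduction to Quadratic Forms* (1963), §63C Example 63:16.
-/

set_option autoImplicit false

noncomputable section

open NumberField IsDedekindDomain Matrix Polynomial
open scoped MatrixGroups

namespace Literature.NumberTheory.Rogawski1990

open Literature.NumberTheory.Automorphic Literature.NumberTheory.Automorphic.UnitaryGroup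
open Literature.NumberTheory.GaloisRepresentations Literature.NumberTheory.NumberFields

/-! ## §1 The anisotropic eigenvector of a type-(2) match -/

section Gram

variable {R : Type*} [CommRing R] {n : Type*} [Fintype n] (σ : R →+* R)

/-- The diagonal Gram entry `(ᵗσ(P) H P)ⱼⱼ` is the `H`-value `Σᵢₖ σ(Pᵢⱼ) Hᵢₖ Pₖⱼ` of the `j`-th column. [cite: Rogawski1990, §3.1 p. 19] -/
theorem twistGram_apply_self_eq_formValue (H P : Matrix n n R) (j : n) :
    twistGram σ H P j j = ∑ i, ∑ k, σ (P i j) * H i k * P k j := by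
  rw [twistGram_def, Matrix.mul_apply, Finset.sum_comm]
  refine Finset.sum_congr rfl fun k _ => ?_
  rw [Matrix.mul_apply, Finset.sum_mul]
  refine Finset.sum_congr rfl fun i _ => ?_
  rw [Matrix.transpose_apply, Matrix.map_apply]

end Gram

variable (L : Type) [Field L] [NumberField L] [IsCMField L] (v : HeightOneSpectrum (𝓞 ↥(maximalRealSubfield L)))
  (H' : Matrix (Fin 3) (Fin 3) L)
  (a : (UnitaryGroup.cmDatum L 2 (Matrix.of fun i j : Fin 2 => if i.val + j.val + 1 = 2 then (1 : L) else 0)).Local v ×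
      (UnitaryGroup.cmDatum L 1 (Matrix.of fun i j : Fin 1 => if i.val + j.val + 1 = 1 then (1 : L) else 0)).Local v)
  (b : (UnitaryGroup.cmDatum L 3 H').Local v)

/-- **An ANISOTROPIC `γ₂`-eigenvector of a type-(2) match**: for `γ_H = (g, u)` with `χ_g` without roots in `L_w` (`v` non-split) and a match `b` (`c ι_v(γ_H) c⁻¹ = b`),
the column `p′ = c e_{u}` is a non-zero `u`-eigenvector of `b` whose `H′_v`-value is the (non-zero) corner of the block-diagonal Gram matrix `ᵗσ(c) H′_v c`.
[cite: Rogawski1990, §3.6 p. 31; §4.3 p. 43; §4.8 Case (a) p. 53] -/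
theorem exists_anisotropic_eigenvector_of_isLocalNormPair (hH' : (H'.map (cmConjRingHom L))ᵀ = H') (hH'u : IsUnit H')
    (w : UnitaryGroup.PlacesOver L v) (hw : IsCMField.complexConj L • w.1 = w.1) (h : IsLocalNormPair L H' v a b)
    (hirr : ¬ ∃ x : w.1.adicCompletion L, (((a.1.val : GL (Fin 2) (UnitaryGroup.LocalRing L v)).val.map
        (Pi.evalRingHom (fun w' : UnitaryGroup.PlacesOver L v => w'.1.adicCompletion L) w)).charpoly).IsRoot x) :
    ∃ p' : Fin 3 → UnitaryGroup.LocalRing L v, p' ≠ 0 ∧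
      (b.val.val : Matrix (Fin 3) (Fin 3) (UnitaryGroup.LocalRing L v)) *ᵥ p' = finGammaTwo L v a • p' ∧
      (∑ i : Fin 3, ∑ k : Fin 3, UnitaryGroup.conjLocal L (IsCMField.complexConj L) v (p' i) *
        ((UnitaryGroup.adelicForm L 3 H').map (UnitaryGroup.adeleToLocal L v)) i k * p' k) ≠ 0 := by
  classical
  obtain ⟨δ₁, hcδ, hδ⟩ : ∃ δ : L, IsCMField.complexConj L δ = -δ ∧ δ ≠ 0 := by
    obtain ⟨ζ, hζ⟩ := not_forall.1 fun h0 => IsCMField.complexConj_ne_one L (AlgEquiv.ext h0)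
    refine ⟨ζ - IsCMField.complexConj L ζ, by rw [map_sub, IsCMField.complexConj_apply_apply, neg_sub], fun h0 => hζ ?_⟩
    rw [sub_eq_zero] at h0
    exact h0.symm
  letI : Field (UnitaryGroup.LocalRing L v) :=
    (Liu2021.LemD1IndexedNonVacuityNonsplitPlace.isField_localRing_of_nonsplit L v (IsCMField.complexConj L) hcδ hδ w hw).toField
  have hσσ : ∀ s, UnitaryGroup.conjLocal L (IsCMField.complexConj L) v (UnitaryGroup.conjLocal L (IsCMField.complexConj L) v s) = s :=
    Liu2021.LemD1OfPlace.conjLocal_conjLocal_apply L v (IsCMField.complexConj L) hcδ hδ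
  -- `χ_g` has no root in the field `L_v`
  have hA : Irreducible ((a.1.val : GL (Fin 2) (UnitaryGroup.LocalRing L v)).val.charpoly) :=
    irreducible_charpoly_of_not_exists_isRoot_eval L v w hw _ hirr
  have hA' : ∀ r : UnitaryGroup.LocalRing L v, (a.1.val : GL (Fin 2) (UnitaryGroup.LocalRing L v)).val.charpoly.eval r ≠ 0 :=
    Literature.LinearAlgebra.Matrix.eval_charpoly_ne_zero_of_irreducible hA (by simp)
  -- the local hermitian data
  have hH := UnitaryGroup.map_conjLocal_transpose_localForm L 3 H' v hH'
  have hHd := UnitaryGroup.isUnit_det_localForm L 3 H' v (Matrix.isUnit_iff_isUnit_det _ |>.1 hH'u).ne_zero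
  -- the block frame `c` of the match and its Gram matrix
  obtain ⟨c, hc⟩ := isConj_iff.1 h
  have hP := mul_eq_mul_reindex_fromBlocks_of_conj_endoEmbLocal_eq L H' a hc
  obtain ⟨G₁, g₃, hT, -, -⟩ := twistGram_blockFrame_eq (UnitaryGroup.conjLocal L (IsCMField.complexConj L) v) endoPerm _ hσσ b.2 hP hA'
  obtain ⟨-, -, -, hg₃0⟩ := blockFrame_gram_hermitian (UnitaryGroup.conjLocal L (IsCMField.complexConj L) v) endoPerm _ hσσ hH hHd.ne_zero hT
  refine ⟨fun i => c.val i (endoPerm (Sum.inr 0)), ?_, mulVec_col_eq_smul_of_blockFrame endoPerm hP, ?_⟩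
  · -- a column of an invertible matrix
    intro h0
    apply (Matrix.isUnits_det_units c).ne_zero
    exact Matrix.det_eq_zero_of_column_eq_zero (endoPerm (Sum.inr 0)) fun i => congrFun h0 i
  · rw [← twistGram_apply_self_eq_formValue, hT, blockFrame_apply_corner]
    exact hg₃0

/-! ## §2 `κ_v = −1` ⇒ ODD order -/

open scoped Classical in
/-- **`κ_v(γ_H, γ′) = −1` ⇒ `ord_v x₀` IS ODD** for the `H′_v`-value `x₀ ≠ 0` of any non-zero `γ₂`-eigenvector `p′` of `γ′` (unramified non-split `v`; ★
`finKappaAt_eq_ite_even_of_nonsplit_of_isUnramifiedIn`) — the «odd norm valuation of the `u`-eigenline» that B-p14's (d1) consumes. [cite: Rogawski1990, §14.6 p. 242; §4.3 p. 43]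
[cite: Omeara1963, §63C Example 63:16] -/
theorem odd_log_valued_of_finKappaAt_eq_neg_one (w : UnitaryGroup.PlacesOver L v) (hw : IsCMField.complexConj L • w.1 = w.1)
    (hunr : Algebra.IsUnramifiedIn (𝓞 L) v.asIdeal) (h : IsLocalNormPair L H' v a b)
    (hu : IsUnit ((finCharpolyTwo L v a).eval (finGammaTwo L v a))) {p' : Fin 3 → UnitaryGroup.LocalRing L v}
    (hp' : (b.val.val : Matrix (Fin 3) (Fin 3) (UnitaryGroup.LocalRing L v)) *ᵥ p' = finGammaTwo L v a • p') (hne : p' ≠ 0)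
    (x₀ : v.adicCompletion ↥(maximalRealSubfield L)) (hx₀ : x₀ ≠ 0)
    (hx : UnitaryGroup.toLocalRing L v x₀ =
      ∑ i : Fin 3, ∑ k : Fin 3, UnitaryGroup.conjLocal L (IsCMField.complexConj L) v (p' i) *
        ((UnitaryGroup.adelicForm L 3 H').map (UnitaryGroup.adeleToLocal L v)) i k * p' k)
    (hκ : finKappaAt L v H' a b = -1) :
    Odd (WithZero.log (Valued.v x₀)) := by
  have hite := finKappaAt_eq_ite_even_of_nonsplit_of_isUnramifiedIn L v H' a b w hw hunr h hu hp' hne x₀ hx₀ hx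
  rw [hκ] at hite
  by_cases heven : Even (WithZero.log (Valued.v x₀))
  · rw [if_pos heven] at hite
    norm_num at hite
  · exact Int.not_even_iff_odd.1 heven

end Literature.NumberTheory.Rogawski1990

end
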